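import Literature.NumberTheory.IwasawaTheory.IwasawaAlgebraProjectiveLimit
import Literature.NumberTheory.EllipticCurves.IwasawaCyclotomicProofs
import HarnessLib

/-!
# EXISTENCE of the Stickelberger-branch series (Lang Ch. 10 Thm 1.2): the layer sums
# `Σ_a ψ(a)(1+T)^{r_n(a)}` vanish modulo `h_n` for `ψ ≠ 1`, integrality, distribution relation, assembly

Literature support for the `𝒞₇` genus road (cell bsd-cm, seat bsd-cm-k-ty1 g23).  THEOREMS ONLY.  The existence of
`f` with `IsStickelbergerSeries p d ψ r f` is reduced in `IwasawaAlgebraProjectiveLimit.lean`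
(`exists_isStickelbergerSeries_of_layers`) to two finite-level congruences; this file proves the tools for them and
the first vanishing statement:

* `isUnit_one_sub_of_pow_eq_one`, `pow_prime_pow_ne_one_of_pow_eq_one`: for `p` odd a root of unity `ζ ≠ 1` of
  `ℤ_p` has `1 − ζ ∈ ℤ_pˣ` and `ζ^{pⁿ} ≠ 1` (`μ(ℤ_p) = μ_{p−1}`, Serre / the tree's
  `PadicInt.torsion_units_le_rootsOfUnity`).
* `one_add_X_pow_sub_pow_mem_of_congr`: `u^a w ≡ m ≡ u^b w (mod p^{j+1})` ⇒ `(1+T)^a ≡ (1+T)^b (mod h_j)`;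
  `IsLogTable.one_add_X_pow_mod_sub_mem` (`σ_{a mod N} = σ_a` on `Γ_n`), `IsLogTable.one_add_X_pow_mul_sub_mem`
  (`σ_{ab} = σ_aσ_b`).
* `sum_filter_coprime_mul_mod_eq`: reindexing `Σ_{a<N,(a,N)=1}` by `a ↦ ab mod N`.
* `sum_character_mul_one_add_X_pow_mem_span_layerModulus`: **`Σ_{a<dp^{n+1},(a,dp)=1} ψ(a)(1+T)^{r_n(a)} ≡ 0
  (mod h_n)` for `ψ ≠ 1`** (the image of `Σ_a ψ(a)σ_a⁻¹`-type sums in `ℤ_p[Γ_n]`: multiplying the index by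
  `b = x^{pⁿ}` multiplies the sum by `ψ(x)^{pⁿ} ≢ 1`).
* (appended) `sum_character_mul_C_mul_one_add_X_pow_mem_sup` (the same modulo `(p^{n+1}, h_n)` with `Y = u(1+T)`),
  `oddBranch_apply_mul_apply` (`ψ(a)ω(a) = θ(a)`), **(hint)** `exists_C_pow_mul_sub_stickelbergerLayer_mem`
  (`L_n ≡ p^{n+1}q_n (mod h_n)`), `IsTeichmullerCharacter.apply_neg_one`, `oddBranch_ne_one`, **(hdist)**
  `stickelbergerLayer_succ_sub_mem` (`L_{n+1} ≡ pL_n (mod h_n)`), and the assembly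
  **`exists_isStickelbergerSeries` / `existsUnique_isStickelbergerSeries`: Lang Ch. 10 Thm 1.2 — for `p` odd,
  `d` prime to `p`, `θ ≠ 1` even, the Stickelberger-branch series `f_{θ,1}` EXISTS (and is unique) in `Λ`.**

## References
S. Lang, Cyclotomic Fields I and II (1990), Ch. 10 §1 Thm 1.1–1.2 (PDF pp. 167–168), §2 (2)–(3) (PDF p. 171)
[Lang1990]; J.-P. Serre, A Course in Arithmetic, Ch. II §3 (structure of `ℤ_pˣ`) [Serre1973].
-/

noncomputable section

open PowerSeries

namespace Literature.NumberTheory.IwasawaTheory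

open StickelbergerSeries Literature.NumberTheory.EllipticCurves

/-! ## Tools for the layer congruences: roots of unity in `ℤ_p`, congruent exponents, the sum over a layer -/

section LayerTools

/-- **`1 − ζ` is a unit for a root of unity `ζ ≠ 1` of `ℤ_p`, `p` odd** (`ζ^{p−1} = 1` by Serre's structure of
`ℤ_pˣ`; if `ζ ≡ 1 (mod p)` then `0 = ζ^{p−1} − 1 = (ζ − 1)·(1 + ζ + ⋯ + ζ^{p−2})` with the second factor
`≡ p − 1`, a unit, forces `ζ = 1`). [cite: Lang1990, Ch. 10 §1 (PDF p. 167, «η(a)^{p−1} = 1», the Teichmüller group μ_{p−1} ⊂ ℤ_p)] -/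
theorem isUnit_one_sub_of_pow_eq_one {p : ℕ} [Fact p.Prime] (hp : p ≠ 2) {ζ : ℤ_[p]} {m : ℕ} (hm : m ≠ 0)
    (hζ : ζ ^ m = 1) (hne : ζ ≠ 1) : IsUnit (1 - ζ) := by
  have hpr : p.Prime := Fact.out
  have h2le := hpr.two_le
  -- `ζ^{p-1} = 1`
  obtain ⟨Z, rfl⟩ := IsUnit.of_pow_eq_one hζ hm
  have htor : Z ∈ CommGroup.torsion ℤ_[p]ˣ := by
    rw [CommGroup.mem_torsion, isOfFinOrder_iff_pow_eq_one]
    exact ⟨m, Nat.pos_of_ne_zero hm, Units.ext (by rw [Units.val_pow_eq_pow_val, hζ, Units.val_one])⟩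
  have hZ := PadicInt.torsion_units_le_rootsOfUnity htor
  rw [mem_rootsOfUnity] at hZ
  have htO : torsionOrder p = p - 1 := by
    rw [torsionOrder, cyclotomicExponent, if_neg hp, pow_one, Nat.totient_prime hpr]
  have hZ1 : (Z : ℤ_[p]) ^ (p - 1) = 1 := by
    rw [← htO, ← Units.val_pow_eq_pow_val, hZ, Units.val_one]
  by_contra hnu
  -- `ζ ≡ 1 (mod p)`
  have hmem : (Z : ℤ_[p]) - 1 ∈ IsLocalRing.maximalIdeal ℤ_[p] := by
    rw [← Ideal.neg_mem_iff, neg_sub]; exact (IsLocalRing.mem_maximalIdeal _).mpr hnu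
  -- the geometric sum is a unit
  set S : ℤ_[p] := ∑ i ∈ Finset.range (p - 1), (Z : ℤ_[p]) ^ i with hS
  have hSsub : S - ((p - 1 : ℕ) : ℤ_[p]) ∈ IsLocalRing.maximalIdeal ℤ_[p] := by
    have e : S - ((p - 1 : ℕ) : ℤ_[p]) = ∑ i ∈ Finset.range (p - 1), ((Z : ℤ_[p]) ^ i - 1) := by
      rw [hS, Finset.sum_sub_distrib, Finset.sum_const, Finset.card_range]; simp
    rw [e]
    refine Ideal.sum_mem _ fun i _ => ?_
    exact Ideal.mem_of_dvd _ (by simpa using sub_dvd_pow_sub_pow (Z : ℤ_[p]) 1 i) hmem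
  have hp1U : IsUnit ((p - 1 : ℕ) : ℤ_[p]) := by
    rw [PadicInt.isUnit_iff]
    have h1 : ‖(((p - 1 : ℕ) : ℤ) : ℤ_[p])‖ ≤ 1 := PadicInt.norm_le_one _
    have h2 : ¬ ‖(((p - 1 : ℕ) : ℤ) : ℤ_[p])‖ < 1 := by
      rw [PadicInt.norm_int_lt_one_iff_dvd, Int.natCast_dvd_natCast]
      intro h
      have := Nat.le_of_dvd (by omega) h
      omega
    push_cast at h1 h2
    exact le_antisymm h1 (not_lt.mp h2)
  have hSU : IsUnit S := by
    by_contra hS'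
    have h1 : S ∈ IsLocalRing.maximalIdeal ℤ_[p] := (IsLocalRing.mem_maximalIdeal _).mpr hS'
    have h2 : ((p - 1 : ℕ) : ℤ_[p]) ∈ IsLocalRing.maximalIdeal ℤ_[p] := by
      have := Ideal.sub_mem _ h1 hSsub; rwa [sub_sub_cancel] at this
    exact (IsLocalRing.mem_maximalIdeal _).mp h2 hp1U
  -- `(ζ − 1)·S = ζ^{p−1} − 1 = 0`
  have hprod : ((Z : ℤ_[p]) - 1) * S = 0 := by
    rw [hS, mul_comm, geom_sum_mul, hZ1, sub_self]
  rcases mul_eq_zero.mp hprod with h | h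
  · exact hne (sub_eq_zero.mp h)
  · exact hSU.ne_zero h

/-- A root of unity `ζ ≠ 1` of `ℤ_p` (`p` odd) has `ζ^{pⁿ} ≠ 1` (its order divides `p − 1`, prime to `pⁿ`).
[cite: Lang1990, Ch. 10 §1 (PDF p. 167, μ_{p−1} ⊂ ℤ_p)] -/
theorem pow_prime_pow_ne_one_of_pow_eq_one {p : ℕ} [Fact p.Prime] (hp : p ≠ 2) {ζ : ℤ_[p]} {m : ℕ} (hm : m ≠ 0)
    (hζ : ζ ^ m = 1) (hne : ζ ≠ 1) (n : ℕ) : ζ ^ (p ^ n) ≠ 1 := by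
  have hpr : p.Prime := Fact.out
  obtain ⟨Z, rfl⟩ := IsUnit.of_pow_eq_one hζ hm
  have htor : Z ∈ CommGroup.torsion ℤ_[p]ˣ := by
    rw [CommGroup.mem_torsion, isOfFinOrder_iff_pow_eq_one]
    exact ⟨m, Nat.pos_of_ne_zero hm, Units.ext (by rw [Units.val_pow_eq_pow_val, hζ, Units.val_one])⟩
  have hZ := PadicInt.torsion_units_le_rootsOfUnity htor
  rw [mem_rootsOfUnity] at hZ
  have htO : torsionOrder p = p - 1 := by
    rw [torsionOrder, cyclotomicExponent, if_neg hp, pow_one, Nat.totient_prime hpr]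
  have hZ1 : (Z : ℤ_[p]) ^ (p - 1) = 1 := by
    rw [← htO, ← Units.val_pow_eq_pow_val, hZ, Units.val_one]
  intro h
  -- `p^n · k ≡ 1 (mod p − 1)` for some `k`
  have hcop : Nat.Coprime (p ^ n) (p - 1) := by
    refine Nat.Coprime.pow_left _ ?_
    rw [Nat.coprime_self_sub_right hpr.one_le]; exact Nat.coprime_one_right _
  have hlt : 1 < p - 1 := by have := hpr.two_le; omega
  obtain ⟨k, -, hk⟩ := Nat.exists_mul_mod_eq_one_of_coprime hcop hlt
  have e : p ^ n * k = (p - 1) * (p ^ n * k / (p - 1)) + 1 := by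
    have := Nat.div_add_mod (p ^ n * k) (p - 1); rw [hk] at this; exact this.symm
  apply hne
  calc (Z : ℤ_[p]) = (Z : ℤ_[p]) ^ (p ^ n * k) := by
        rw [e, pow_add, pow_one, pow_mul, hZ1, one_pow, one_mul]
    _ = 1 := by rw [pow_mul, h, one_pow]


/-- **Congruent exponents give congruent powers of `1 + T`**: if `u^a·w ≡ m ≡ u^b·w (mod p^{j+1})` for a unit
`w` (`u` a topological generator, `p` odd) then `(1+T)^a ≡ (1+T)^b (mod h_j)` (`pʲ ∣ a − b` by the order of `u`).
[cite: Lang1990, Ch. 10 §1 Thm 1.2 (PDF p. 168, «r(a) … mod pⁿ»)] -/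
theorem StickelbergerSeries.one_add_X_pow_sub_pow_mem_of_congr {p : ℕ} [Fact p.Prime] (hp : p ≠ 2) {u : ℤ_[p]}
    (hu : KubotaLeopoldt.IsTopGenerator p u) {j a b : ℕ} {w m : ℤ_[p]} (hw : IsUnit w)
    (ha : u ^ a * w - m ∈ Ideal.span {(p : ℤ_[p]) ^ (j + 1)})
    (hb : u ^ b * w - m ∈ Ideal.span {(p : ℤ_[p]) ^ (j + 1)}) :
    ((1 + X : IwasawaAlgebra p) ^ a - (1 + X) ^ b) ∈ Ideal.span {layerModulus p j} := by
  have h1 : (u ^ a - u ^ b) * w ∈ Ideal.span {(p : ℤ_[p]) ^ (j + 1)} := by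
    have e : (u ^ a - u ^ b) * w = (u ^ a * w - m) - (u ^ b * w - m) := by ring
    rw [e]; exact Ideal.sub_mem _ ha hb
  have h2 : u ^ a - u ^ b ∈ Ideal.span {(p : ℤ_[p]) ^ (j + 1)} := (Ideal.mul_unit_mem_iff_mem _ hw).mp h1
  have huu : IsUnit u := hu.isUnit
  rcases le_total b a with hab | hab
  · have h3 : u ^ (a - b) - 1 ∈ Ideal.span {(p : ℤ_[p]) ^ (j + 1)} := by
      have e : u ^ a - u ^ b = u ^ b * (u ^ (a - b) - 1) := by
        rw [mul_sub, mul_one, ← pow_add, Nat.add_sub_cancel' hab]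
      rw [e] at h2
      exact (Ideal.unit_mul_mem_iff_mem _ (huu.pow _)).mp h2
    exact one_add_X_pow_sub_pow_mem_span_layerModulus (hu.prime_pow_dvd_of_pow_sub_one_mem p hp h3) hab
  · have h3 : u ^ (b - a) - 1 ∈ Ideal.span {(p : ℤ_[p]) ^ (j + 1)} := by
      have e : u ^ a - u ^ b = -(u ^ a * (u ^ (b - a) - 1)) := by
        rw [mul_sub, mul_one, ← pow_add, Nat.add_sub_cancel' hab, neg_sub]
      rw [e, Ideal.neg_mem_iff] at h2
      exact (Ideal.unit_mul_mem_iff_mem _ (huu.pow _)).mp h2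
    rw [← Ideal.neg_mem_iff, neg_sub]
    exact one_add_X_pow_sub_pow_mem_span_layerModulus (hu.prime_pow_dvd_of_pow_sub_one_mem p hp h3) hab

/-- The value of a Dirichlet character mod `p` at a natural number prime to `p` is a unit.
[cite: Lang1990, Ch. 10 §1 (PDF p. 167)] -/
theorem isUnit_apply_natCast_of_coprime {p : ℕ} [Fact p.Prime] (ω : DirichletCharacter ℤ_[p] p) {a : ℕ}
    (ha : a.Coprime p) : IsUnit (ω (a : ZMod p)) := by
  have hau : IsUnit (a : ZMod p) := by rw [← ZMod.coe_unitOfCoprime a ha]; exact Units.isUnit _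
  exact hau.map ω

/-- **The layer of `σ_a` read at a residue**: for `p^{n+1} ∣ N` and `a` prime to `p`,
`(1+T)^{r_n(a mod N)} ≡ (1+T)^{r_n(a)} (mod h_n)`. [cite: Lang1990, Ch. 10 §1 Thm 1.2 (PDF p. 168)] -/
theorem StickelbergerSeries.IsLogTable.one_add_X_pow_mod_sub_mem {p : ℕ} [Fact p.Prime] (hp : p ≠ 2) {u : ℤ_[p]}
    (hu : KubotaLeopoldt.IsTopGenerator p u) {ω : DirichletCharacter ℤ_[p] p} {r : ℕ → ℕ → ℕ}
    (hr : IsLogTable p u ω r) {n N a : ℕ} (hN : p ^ (n + 1) ∣ N) (ha : a.Coprime p) :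
    ((1 + X : IwasawaAlgebra p) ^ (r n (a % N)) - (1 + X) ^ (r n a)) ∈ Ideal.span {layerModulus p n} := by
  have hpN : p ∣ N := (dvd_pow_self p (Nat.succ_ne_zero n)).trans hN
  have hmodp : ((a % N : ℕ) : ZMod p) = (a : ZMod p) := by
    rw [ZMod.natCast_eq_natCast_iff', Nat.mod_mod_of_dvd a hpN]
  have ha' : (a % N).Coprime p := by
    rw [Nat.coprime_comm, Nat.Prime.coprime_iff_not_dvd Fact.out] at ha ⊢
    intro h
    exact ha ((Nat.dvd_mod_iff hpN).mp h)
  have h1 := hr n (a % N) ha'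
  rw [hmodp] at h1
  -- `a % N ≡ a (mod p^{n+1})`
  have h2 : ((a % N : ℕ) : ℤ_[p]) - (a : ℤ_[p]) ∈ Ideal.span {(p : ℤ_[p]) ^ (n + 1)} := by
    rw [← Ideal.neg_mem_iff, neg_sub, Ideal.mem_span_singleton]
    have e : (a : ℤ_[p]) - ((a % N : ℕ) : ℤ_[p]) = ((N * (a / N) : ℕ) : ℤ_[p]) := by
      have e' : (a : ℤ_[p]) = ((N * (a / N) : ℕ) : ℤ_[p]) + ((a % N : ℕ) : ℤ_[p]) := by
        exact_mod_cast (Nat.div_add_mod a N).symm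
      rw [e']; ring
    rw [e]
    obtain ⟨q, hq⟩ := hN
    exact ⟨(q * (a / N) : ℕ), by rw [hq]; push_cast; ring⟩
  have h3 : u ^ (r n (a % N)) * ω (a : ZMod p) - (a : ℤ_[p]) ∈ Ideal.span {(p : ℤ_[p]) ^ (n + 1)} := by
    have e : u ^ (r n (a % N)) * ω (a : ZMod p) - (a : ℤ_[p]) =
        (u ^ (r n (a % N)) * ω (a : ZMod p) - ((a % N : ℕ) : ℤ_[p])) + (((a % N : ℕ) : ℤ_[p]) - a) := by ring
    rw [e]; exact Ideal.add_mem _ h1 h2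
  exact one_add_X_pow_sub_pow_mem_of_congr hp hu (isUnit_apply_natCast_of_coprime ω ha) h3 (hr n a ha)

/-- **The layers are multiplicative**: `(1+T)^{r_n(ab)} ≡ (1+T)^{r_n(a)}·(1+T)^{r_n(b)} (mod h_n)` for `a, b` prime to
`p` (`σ_{ab} = σ_aσ_b`). [cite: Lang1990, Ch. 10 §1 Thm 1.2 (PDF p. 168)] -/
theorem StickelbergerSeries.IsLogTable.one_add_X_pow_mul_sub_mem {p : ℕ} [Fact p.Prime] (hp : p ≠ 2) {u : ℤ_[p]}
    (hu : KubotaLeopoldt.IsTopGenerator p u) {ω : DirichletCharacter ℤ_[p] p} {r : ℕ → ℕ → ℕ}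
    (hr : IsLogTable p u ω r) {n a b : ℕ} (ha : a.Coprime p) (hb : b.Coprime p) :
    ((1 + X : IwasawaAlgebra p) ^ (r n (a * b)) - (1 + X) ^ (r n a) * (1 + X) ^ (r n b)) ∈
      Ideal.span {layerModulus p n} := by
  rw [← pow_add]
  have hab : (a * b).Coprime p := Nat.Coprime.mul_left ha hb
  have h1 := hr n (a * b) hab
  have hω : ω ((a * b : ℕ) : ZMod p) = ω (a : ZMod p) * ω (b : ZMod p) := by
    rw [Nat.cast_mul, map_mul]
  have h2 : u ^ (r n a + r n b) * ω ((a * b : ℕ) : ZMod p) - ((a * b : ℕ) : ℤ_[p]) ∈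
      Ideal.span {(p : ℤ_[p]) ^ (n + 1)} := by
    have e : u ^ (r n a + r n b) * ω ((a * b : ℕ) : ZMod p) - ((a * b : ℕ) : ℤ_[p]) =
        (u ^ (r n a) * ω (a : ZMod p) - a) * (u ^ (r n b) * ω (b : ZMod p)) +
          (a : ℤ_[p]) * (u ^ (r n b) * ω (b : ZMod p) - b) := by
      rw [hω, pow_add]; push_cast; ring
    rw [e]
    exact Ideal.add_mem _ (Ideal.mul_mem_right _ _ (hr n a ha)) (Ideal.mul_mem_left _ _ (hr n b hb))
  exact one_add_X_pow_sub_pow_mem_of_congr hp hu (isUnit_apply_natCast_of_coprime ω hab) h1 h2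

/-- **Reindexing a sum over the prime-to-`M` residues below `N` by multiplication with `b` prime to `N`**
(`rad M = rad N`-free form: the predicate is `Coprime · N`). [cite: Lang1990, Ch. 10 §1 (PDF p. 167, sums over (ℤ/dp^{n+1})*)] -/
theorem sum_filter_coprime_mul_mod_eq {M : Type*} [AddCommMonoid M] {N b : ℕ} (hN : 0 < N) (hb : b.Coprime N)
    (G : ℕ → M) :
    ∑ a ∈ (Finset.range N).filter (fun a => a.Coprime N), G (a * b % N) =
      ∑ a ∈ (Finset.range N).filter (fun a => a.Coprime N), G a := by
  set S := (Finset.range N).filter (fun a => a.Coprime N) with hS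
  have hmaps : Set.MapsTo (fun a => a * b % N) (S : Set ℕ) (S : Set ℕ) := by
    intro a ha
    simp only [hS, Finset.coe_filter, Set.mem_setOf_eq, Finset.mem_range] at ha ⊢
    refine ⟨Nat.mod_lt _ hN, ?_⟩
    have h1 : (a * b).Coprime N := Nat.Coprime.mul_left ha.2 hb
    unfold Nat.Coprime at h1 ⊢
    rw [← Nat.gcd_rec] at *
    rwa [Nat.gcd_comm] at h1
  have hinj : Set.InjOn (fun a => a * b % N) (S : Set ℕ) := by
    intro a₁ h₁ a₂ h₂ h
    simp only [hS, Finset.coe_filter, Set.mem_setOf_eq, Finset.mem_range] at h₁ h₂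
    have hmod : a₁ * b ≡ a₂ * b [MOD N] := h
    have := Nat.ModEq.cancel_right_of_coprime (c := b) (by rw [Nat.gcd_comm]; exact hb) hmod
    exact Nat.ModEq.eq_of_lt_of_lt this h₁.1 h₂.1
  have hsurj : Set.SurjOn (fun a => a * b % N) (S : Set ℕ) (S : Set ℕ) :=
    Finset.surjOn_of_injOn_of_card_le _ hmaps hinj le_rfl
  exact Finset.sum_nbij (fun a => a * b % N) hmaps hinj hsurj (fun a _ => rfl)

/-- **The character-weighted sum of a layer vanishes modulo `h_n`**: for `p` odd, `d` prime to `p` and a Dirichlet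
character `ψ ≠ 1` mod `dp`, `Σ_{a < dp^{n+1}, (a, dp) = 1} ψ(a)·(1+T)^{r_n(a)} ≡ 0 (mod h_n)` — multiplying the
summation index by `b = x^{pⁿ}` (`ψ(x) ≠ 1`) multiplies the sum by `ψ(b)(1+T)^{r_n(b)} ≡ ψ(x)^{pⁿ} ≢ 1`, and
`1 − ψ(x)^{pⁿ}` is a unit.  (The vanishing of the «`−½`-part» of the Stickelberger layer; Lang absorbs it in the
regularised measure `E_{1,c}`.) [cite: Lang1990, Ch. 10 §1 Thm 1.1–1.2 (PDF pp. 167–168), §2 (2)–(3) (PDF p. 171)] -/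
theorem StickelbergerSeries.sum_character_mul_one_add_X_pow_mem_span_layerModulus {p : ℕ} [Fact p.Prime]
    (hp : p ≠ 2) {d : ℕ} (hd : d.Coprime p) {u : ℤ_[p]} (hu : KubotaLeopoldt.IsTopGenerator p u)
    {ω : DirichletCharacter ℤ_[p] p} {r : ℕ → ℕ → ℕ} (hr : IsLogTable p u ω r)
    {ψ : DirichletCharacter ℤ_[p] (d * p)} (hψ : ψ ≠ 1) (n : ℕ) :
    (∑ a ∈ (Finset.range (d * p ^ (n + 1))).filter (fun a => a.Coprime (d * p)),
      C (ψ (a : ZMod (d * p))) * (1 + X : IwasawaAlgebra p) ^ (r n a)) ∈ Ideal.span {layerModulus p n} := by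
  have hpr : p.Prime := Fact.out
  set N := d * p ^ (n + 1) with hNdef
  have hd0 : 0 < d := Nat.pos_of_ne_zero (by rintro rfl; simp [Nat.coprime_zero_left, hpr.ne_one] at hd)
  have hN0 : 0 < N := Nat.mul_pos hd0 (pow_pos hpr.pos _)
  have hdpN : d * p ∣ N := ⟨p ^ n, by rw [hNdef, pow_succ]; ring⟩
  have hpN : p ^ (n + 1) ∣ N := Dvd.intro_left d rfl
  -- coprimality to `d·p` and to `N` agree
  have hcop : ∀ a : ℕ, a.Coprime (d * p) ↔ a.Coprime N := by
    intro a
    rw [hNdef, Nat.coprime_mul_iff_right, Nat.coprime_mul_iff_right, Nat.coprime_pow_right_iff (Nat.succ_pos n)]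
  have hfilt : (Finset.range N).filter (fun a => a.Coprime (d * p)) = (Finset.range N).filter (fun a => a.Coprime N) :=
    Finset.filter_congr fun a _ => hcop a
  rw [hfilt]
  set S := (Finset.range N).filter (fun a => a.Coprime N) with hS
  set G : ℕ → IwasawaAlgebra p := fun a => C (ψ (a : ZMod (d * p))) * (1 + X : IwasawaAlgebra p) ^ (r n a) with hG
  -- a witness `x` of `ψ ≠ 1`, and `b = x^{pⁿ}`
  obtain ⟨xu, hxu⟩ := MulChar.ne_one_iff.mp hψ
  set x : ℕ := (xu : ZMod (d * p)).val with hx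
  haveI : NeZero (d * p) := ⟨Nat.pos_iff_ne_zero.mp (Nat.mul_pos hd0 hpr.pos)⟩
  have hxcast : (x : ZMod (d * p)) = (xu : ZMod (d * p)) := by rw [hx, ZMod.natCast_zmod_val]
  have hxcop : x.Coprime (d * p) := by rw [hx]; exact ZMod.val_coe_unit_coprime xu
  have hxp : x.Coprime p := Nat.Coprime.coprime_mul_left_right hxcop
  set b : ℕ := x ^ (p ^ n) with hbdef
  have hbcop : b.Coprime (d * p) := Nat.Coprime.pow_left _ hxcop
  have hbp : b.Coprime p := Nat.Coprime.coprime_mul_left_right hbcop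
  have hbN : b.Coprime N := (hcop b).mp hbcop
  -- (1) reindex by `a ↦ ab mod N`
  have hre : ∑ a ∈ S, G (a * b % N) = ∑ a ∈ S, G a := sum_filter_coprime_mul_mod_eq hN0 hbN G
  -- (2) termwise: `G(ab mod N) ≡ ψ(b)(1+T)^{r b} · G(a)`
  have hterm : ∀ a ∈ S, G (a * b % N) - (C (ψ (b : ZMod (d * p))) * (1 + X) ^ (r n b)) * G a ∈
      Ideal.span {layerModulus p n} := by
    intro a ha
    simp only [hS, Finset.mem_filter, Finset.mem_range] at ha
    have hap : a.Coprime p := Nat.Coprime.coprime_mul_left_right ((hcop a).mpr ha.2)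
    have habp : (a * b).Coprime p := Nat.Coprime.mul_left hap hbp
    have hcast : ((a * b % N : ℕ) : ZMod (d * p)) = (a : ZMod (d * p)) * (b : ZMod (d * p)) := by
      rw [← Nat.cast_mul, ZMod.natCast_eq_natCast_iff', Nat.mod_mod_of_dvd _ hdpN]
    have h1 := hr.one_add_X_pow_mod_sub_mem hp hu (N := N) hpN habp   -- r(ab % N) vs r(ab)
    have h2 := hr.one_add_X_pow_mul_sub_mem hp hu (n := n) hap hbp     -- r(ab) vs r a + r b
    have e : G (a * b % N) - (C (ψ (b : ZMod (d * p))) * (1 + X) ^ (r n b)) * G a =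
        C (ψ (a : ZMod (d * p)) * ψ (b : ZMod (d * p))) *
          (((1 + X : IwasawaAlgebra p) ^ (r n (a * b % N)) - (1 + X) ^ (r n (a * b))) +
           ((1 + X : IwasawaAlgebra p) ^ (r n (a * b)) - (1 + X) ^ (r n a) * (1 + X) ^ (r n b))) := by
      simp only [hG, hcast, map_mul]; ring
    rw [e]
    exact Ideal.mul_mem_left _ _ (Ideal.add_mem _ h1 h2)
  -- (3) hence `T ≡ ψ(b)(1+T)^{r b}·T`
  have hT : (1 - C (ψ (b : ZMod (d * p))) * (1 + X) ^ (r n b)) * ∑ a ∈ S, G a ∈ Ideal.span {layerModulus p n} := by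
    have e : (1 - C (ψ (b : ZMod (d * p))) * (1 + X) ^ (r n b)) * ∑ a ∈ S, G a =
        ∑ a ∈ S, (G (a * b % N) - (C (ψ (b : ZMod (d * p))) * (1 + X) ^ (r n b)) * G a) := by
      rw [Finset.sum_sub_distrib, hre, ← Finset.mul_sum]; ring
    rw [e]
    exact Ideal.sum_mem _ hterm
  -- (4) `(1+T)^{r_n b} ≡ 1`: `u^{r b}ω(b) ≡ b = x^{pⁿ} ≡ (u^{r x}ω(x))^{pⁿ}`
  have hone : ((1 + X : IwasawaAlgebra p) ^ (r n b) - 1) ∈ Ideal.span {layerModulus p n} := by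
    have h1 := hr n b hbp
    have h2 : u ^ (p ^ n * r n x) * ω (b : ZMod p) - (b : ℤ_[p]) ∈ Ideal.span {(p : ℤ_[p]) ^ (n + 1)} := by
      have hωb : ω (b : ZMod p) = ω (x : ZMod p) ^ (p ^ n) := by rw [hbdef, Nat.cast_pow, map_pow]
      rw [hωb, pow_mul', ← mul_pow, hbdef, Nat.cast_pow]
      exact Ideal.mem_of_dvd _ (sub_dvd_pow_sub_pow _ _ _) (hr n x hxp)
    have h3 := one_add_X_pow_sub_pow_mem_of_congr hp hu (isUnit_apply_natCast_of_coprime ω hbp) h1 h2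
    have h4 : ((1 + X : IwasawaAlgebra p) ^ (p ^ n * r n x) - 1) ∈ Ideal.span {layerModulus p n} := by
      refine Ideal.mem_span_singleton.mpr ?_
      rw [pow_mul, layerModulus_def]
      simpa using sub_dvd_pow_sub_pow ((1 + X : IwasawaAlgebra p) ^ (p ^ n)) 1 (r n x)
    have e : ((1 + X : IwasawaAlgebra p) ^ (r n b) - 1) =
        ((1 + X : IwasawaAlgebra p) ^ (r n b) - (1 + X) ^ (p ^ n * r n x)) +
          ((1 + X : IwasawaAlgebra p) ^ (p ^ n * r n x) - 1) := by ring
    rw [e]; exact Ideal.add_mem _ h3 h4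
  -- (5) `1 − ψ(b)` is a unit
  have hunit : IsUnit (C (1 - ψ (b : ZMod (d * p))) : IwasawaAlgebra p) := by
    refine IsUnit.map C ?_
    have hψb : ψ (b : ZMod (d * p)) = ψ (xu : ZMod (d * p)) ^ (p ^ n) := by
      rw [hbdef, Nat.cast_pow, map_pow, hxcast]
    rw [hψb]
    -- `ψ(xu)` is a root of unity `≠ 1`
    have hfin : ψ (xu : ZMod (d * p)) ^ (Fintype.card (ZMod (d * p))ˣ) = 1 := by
      rw [← MulChar.coe_toUnitHom, ← Units.val_pow_eq_pow_val, ← map_pow, pow_card_eq_one, map_one, Units.val_one]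
    have hne : ψ (xu : ZMod (d * p)) ^ (p ^ n) ≠ 1 :=
      pow_prime_pow_ne_one_of_pow_eq_one hp Fintype.card_ne_zero hfin hxu n
    refine isUnit_one_sub_of_pow_eq_one hp (m := Fintype.card (ZMod (d * p))ˣ) Fintype.card_ne_zero ?_ hne
    rw [← pow_mul, Nat.mul_comm (p ^ n) (Fintype.card (ZMod (d * p))ˣ), pow_mul, hfin, one_pow]
  -- (6) assemble: `(1 − ψ b)·T = (1 − ψ(b)(1+T)^{rb})·T + ψ(b)((1+T)^{rb} − 1)·T`
  have hfinal : C (1 - ψ (b : ZMod (d * p))) * ∑ a ∈ S, G a ∈ Ideal.span {layerModulus p n} := by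
    have e : C (1 - ψ (b : ZMod (d * p))) * ∑ a ∈ S, G a =
        (1 - C (ψ (b : ZMod (d * p))) * (1 + X) ^ (r n b)) * ∑ a ∈ S, G a +
          C (ψ (b : ZMod (d * p))) * (((1 + X : IwasawaAlgebra p) ^ (r n b) - 1) * ∑ a ∈ S, G a) := by
      rw [map_sub, map_one]; ring
    rw [e]
    exact Ideal.add_mem _ hT (Ideal.mul_mem_left _ _ (Ideal.mul_mem_right _ _ hone))
  exact (Ideal.unit_mul_mem_iff_mem _ hunit).mp hfinal

end LayerTools


/-! ## The integrality congruence (hint): `Σ_a θ(a)·(u(1+T))^{r_n(a)} ∈ (p^{n+1}, h_n)` for `θ ≠ 1` -/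

section Integrality

/-- `u ≡ 1 (mod p)` and `pʲ ∣ m` give `u^m ≡ 1 (mod p^{j+1})` (binomial theorem).
[cite: Lang1990, Ch. 10 §1 (PDF p. 167, «γ^{pⁿ} topological generator of 1 + p^{n+1}ℤ_p»)] -/
theorem pow_sub_one_mem_span_pow_succ_of_dvd {p : ℕ} [Fact p.Prime] {u : ℤ_[p]} (hu : (p : ℤ_[p]) ∣ u - 1)
    {j m : ℕ} (hm : p ^ j ∣ m) : u ^ m - 1 ∈ Ideal.span {(p : ℤ_[p]) ^ (j + 1)} := by
  obtain ⟨k, rfl⟩ := hm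
  rw [Ideal.mem_span_singleton]
  have h1 : (p : ℤ_[p]) ^ (j + 1) ∣ u ^ p ^ j - 1 := by
    simpa using dvd_sub_pow_of_dvd_sub hu j
  rw [pow_mul]
  exact h1.trans (by simpa using sub_dvd_pow_sub_pow (u ^ p ^ j) 1 k)

/-- Congruent exponents: `u^a·w ≡ m ≡ u^b·w (mod p^{j+1})` with `w` a unit gives `u^a ≡ u^b (mod p^{j+1})`.
[cite: Lang1990, Ch. 10 §1 Thm 1.2 (PDF p. 168)] -/
theorem pow_sub_pow_mem_of_congr {p : ℕ} [Fact p.Prime] {u : ℤ_[p]} {j a b : ℕ} {w m : ℤ_[p]} (hw : IsUnit w)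
    (ha : u ^ a * w - m ∈ Ideal.span {(p : ℤ_[p]) ^ (j + 1)})
    (hb : u ^ b * w - m ∈ Ideal.span {(p : ℤ_[p]) ^ (j + 1)}) :
    u ^ a - u ^ b ∈ Ideal.span {(p : ℤ_[p]) ^ (j + 1)} := by
  have h1 : (u ^ a - u ^ b) * w ∈ Ideal.span {(p : ℤ_[p]) ^ (j + 1)} := by
    have e : (u ^ a - u ^ b) * w = (u ^ a * w - m) - (u ^ b * w - m) := by ring
    rw [e]; exact Ideal.sub_mem _ ha hb
  exact (Ideal.mul_unit_mem_iff_mem _ hw).mp h1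

/-- `C` carries `(p^k) ⊂ ℤ_p` into `(C p^k) ⊂ Λ`. [cite: Lang1990, Ch. 5 §1 (PDF p. 115)] -/
theorem C_mem_span_C_of_mem_span {p : ℕ} [Fact p.Prime] {x y : ℤ_[p]} (h : x ∈ Ideal.span {y}) :
    (C x : IwasawaAlgebra p) ∈ Ideal.span {(C y : IwasawaAlgebra p)} := by
  obtain ⟨c, rfl⟩ := Ideal.mem_span_singleton'.mp h
  exact Ideal.mem_span_singleton'.mpr ⟨C c, by rw [map_mul]⟩

/-- **Congruent exponents give congruent powers of `Y = u·(1+T)` modulo `(p^{j+1}, h_j)`**.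
[cite: Lang1990, Ch. 10 §1 Thm 1.2 (PDF p. 168)] -/
theorem StickelbergerSeries.C_mul_one_add_X_pow_sub_pow_mem_of_congr {p : ℕ} [Fact p.Prime] (hp : p ≠ 2)
    {u : ℤ_[p]} (hu : KubotaLeopoldt.IsTopGenerator p u) {j a b : ℕ} {w m : ℤ_[p]} (hw : IsUnit w)
    (ha : u ^ a * w - m ∈ Ideal.span {(p : ℤ_[p]) ^ (j + 1)})
    (hb : u ^ b * w - m ∈ Ideal.span {(p : ℤ_[p]) ^ (j + 1)}) :
    ((C u * (1 + X) : IwasawaAlgebra p) ^ a - (C u * (1 + X)) ^ b) ∈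
      Ideal.span {(C ((p : ℤ_[p]) ^ (j + 1)) : IwasawaAlgebra p)} ⊔ Ideal.span {layerModulus p j} := by
  have e : ((C u * (1 + X) : IwasawaAlgebra p) ^ a - (C u * (1 + X)) ^ b) =
      C (u ^ a) * ((1 + X : IwasawaAlgebra p) ^ a - (1 + X) ^ b) + C (u ^ a - u ^ b) * (1 + X) ^ b := by
    rw [mul_pow, mul_pow, map_sub, ← map_pow, ← map_pow]; ring
  rw [e]
  refine Ideal.add_mem _ (Ideal.mem_sup_right (Ideal.mul_mem_left _ _
    (one_add_X_pow_sub_pow_mem_of_congr hp hu hw ha hb))) (Ideal.mem_sup_left (Ideal.mul_mem_right _ _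
    (C_mem_span_C_of_mem_span (pow_sub_pow_mem_of_congr hw ha hb))))

/-- The `ℤ_p`-congruence behind `σ_{a mod N} = σ_a`: `u^{r_n(a mod N)}ω(a) ≡ a (mod p^{n+1})` for `p^{n+1} ∣ N`.
[cite: Lang1990, Ch. 10 §1 Thm 1.2 (PDF p. 168)] -/
theorem StickelbergerSeries.IsLogTable.pow_mod_mul_sub_mem {p : ℕ} [Fact p.Prime] {u : ℤ_[p]}
    {ω : DirichletCharacter ℤ_[p] p} {r : ℕ → ℕ → ℕ} (hr : IsLogTable p u ω r) {n N a : ℕ}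
    (hN : p ^ (n + 1) ∣ N) (ha : a.Coprime p) :
    u ^ (r n (a % N)) * ω (a : ZMod p) - (a : ℤ_[p]) ∈ Ideal.span {(p : ℤ_[p]) ^ (n + 1)} := by
  have hpN : p ∣ N := (dvd_pow_self p (Nat.succ_ne_zero n)).trans hN
  have hmodp : ((a % N : ℕ) : ZMod p) = (a : ZMod p) := by
    rw [ZMod.natCast_eq_natCast_iff', Nat.mod_mod_of_dvd a hpN]
  have ha' : (a % N).Coprime p := by
    rw [Nat.coprime_comm, Nat.Prime.coprime_iff_not_dvd Fact.out] at ha ⊢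
    intro h
    exact ha ((Nat.dvd_mod_iff hpN).mp h)
  have h1 := hr n (a % N) ha'
  rw [hmodp] at h1
  have h2 : ((a % N : ℕ) : ℤ_[p]) - (a : ℤ_[p]) ∈ Ideal.span {(p : ℤ_[p]) ^ (n + 1)} := by
    rw [← Ideal.neg_mem_iff, neg_sub, Ideal.mem_span_singleton]
    have e : (a : ℤ_[p]) - ((a % N : ℕ) : ℤ_[p]) = ((N * (a / N) : ℕ) : ℤ_[p]) := by
      have e' : (a : ℤ_[p]) = ((N * (a / N) : ℕ) : ℤ_[p]) + ((a % N : ℕ) : ℤ_[p]) := by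
        exact_mod_cast (Nat.div_add_mod a N).symm
      rw [e']; ring
    rw [e]
    obtain ⟨q, hq⟩ := hN
    exact ⟨(q * (a / N) : ℕ), by rw [hq]; push_cast; ring⟩
  have e : u ^ (r n (a % N)) * ω (a : ZMod p) - (a : ℤ_[p]) =
      (u ^ (r n (a % N)) * ω (a : ZMod p) - ((a % N : ℕ) : ℤ_[p])) + (((a % N : ℕ) : ℤ_[p]) - a) := by ring
  rw [e]; exact Ideal.add_mem _ h1 h2

/-- The `ℤ_p`-congruence behind `σ_{ab} = σ_aσ_b`: `u^{r_n(a) + r_n(b)}ω(ab) ≡ ab (mod p^{n+1})`.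
[cite: Lang1990, Ch. 10 §1 Thm 1.2 (PDF p. 168)] -/
theorem StickelbergerSeries.IsLogTable.pow_add_mul_sub_mem {p : ℕ} [Fact p.Prime] {u : ℤ_[p]}
    {ω : DirichletCharacter ℤ_[p] p} {r : ℕ → ℕ → ℕ} (hr : IsLogTable p u ω r) {n a b : ℕ}
    (ha : a.Coprime p) (hb : b.Coprime p) :
    u ^ (r n a + r n b) * ω ((a * b : ℕ) : ZMod p) - ((a * b : ℕ) : ℤ_[p]) ∈
      Ideal.span {(p : ℤ_[p]) ^ (n + 1)} := by
  have hω : ω ((a * b : ℕ) : ZMod p) = ω (a : ZMod p) * ω (b : ZMod p) := by rw [Nat.cast_mul, map_mul]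
  have e : u ^ (r n a + r n b) * ω ((a * b : ℕ) : ZMod p) - ((a * b : ℕ) : ℤ_[p]) =
      (u ^ (r n a) * ω (a : ZMod p) - a) * (u ^ (r n b) * ω (b : ZMod p)) +
        (a : ℤ_[p]) * (u ^ (r n b) * ω (b : ZMod p) - b) := by
    rw [hω, pow_add]; push_cast; ring
  rw [e]
  exact Ideal.add_mem _ (Ideal.mul_mem_right _ _ (hr n a ha)) (Ideal.mul_mem_left _ _ (hr n b hb))

/-- **`Σ_{a<dp^{n+1},(a,dp)=1} θ(a)·(u(1+T))^{r_n(a)} ∈ (p^{n+1}, h_n)` for `θ ≠ 1`** — the integrality of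
`N_n⁻¹·(the Stickelberger layer)` up to the `IsLogTable` correction: the same unit trick as
`sum_character_mul_one_add_X_pow_mem_span_layerModulus`, run modulo `(p^{n+1}, h_n)` with `Y = u(1+T)`
(`Y^{r(ab)} ≡ Y^{r(a)}Y^{r(b)}`, `Y^{r(x^{pⁿ})} ≡ 1`).
[cite: Lang1990, Ch. 10 §1 Thm 1.1–1.2 (PDF pp. 167–168, «μ is 𝔬-valued … f ∈ 𝔬[[X]]»), §2 (PDF p. 171, «if θ ≠ 1 … f ∈ Λ»)] -/
theorem StickelbergerSeries.sum_character_mul_C_mul_one_add_X_pow_mem_sup {p : ℕ} [Fact p.Prime]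
    (hp : p ≠ 2) {d : ℕ} (hd : d.Coprime p) {u : ℤ_[p]} (hu : KubotaLeopoldt.IsTopGenerator p u)
    {ω : DirichletCharacter ℤ_[p] p} {r : ℕ → ℕ → ℕ} (hr : IsLogTable p u ω r)
    {θ : DirichletCharacter ℤ_[p] (d * p)} (hθ : θ ≠ 1) (n : ℕ) :
    (∑ a ∈ (Finset.range (d * p ^ (n + 1))).filter (fun a => a.Coprime (d * p)),
      C (θ (a : ZMod (d * p))) * (C u * (1 + X) : IwasawaAlgebra p) ^ (r n a)) ∈
      Ideal.span {(C ((p : ℤ_[p]) ^ (n + 1)) : IwasawaAlgebra p)} ⊔ Ideal.span {layerModulus p n} := by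
  have hpr : p.Prime := Fact.out
  set I : Ideal (IwasawaAlgebra p) :=
    Ideal.span {(C ((p : ℤ_[p]) ^ (n + 1)) : IwasawaAlgebra p)} ⊔ Ideal.span {layerModulus p n} with hI
  set Y : IwasawaAlgebra p := C u * (1 + X) with hY
  set N := d * p ^ (n + 1) with hNdef
  have hd0 : 0 < d := Nat.pos_of_ne_zero (by rintro rfl; simp [Nat.coprime_zero_left, hpr.ne_one] at hd)
  have hN0 : 0 < N := Nat.mul_pos hd0 (pow_pos hpr.pos _)
  have hdpN : d * p ∣ N := ⟨p ^ n, by rw [hNdef, pow_succ]; ring⟩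
  have hpN : p ^ (n + 1) ∣ N := Dvd.intro_left d rfl
  have hcop : ∀ a : ℕ, a.Coprime (d * p) ↔ a.Coprime N := by
    intro a
    rw [hNdef, Nat.coprime_mul_iff_right, Nat.coprime_mul_iff_right, Nat.coprime_pow_right_iff (Nat.succ_pos n)]
  have hfilt : (Finset.range N).filter (fun a => a.Coprime (d * p)) = (Finset.range N).filter (fun a => a.Coprime N) :=
    Finset.filter_congr fun a _ => hcop a
  rw [hfilt]
  set S := (Finset.range N).filter (fun a => a.Coprime N) with hS
  set G : ℕ → IwasawaAlgebra p := fun a => C (θ (a : ZMod (d * p))) * Y ^ (r n a) with hG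
  obtain ⟨xu, hxu⟩ := MulChar.ne_one_iff.mp hθ
  set x : ℕ := (xu : ZMod (d * p)).val with hx
  haveI : NeZero (d * p) := ⟨Nat.pos_iff_ne_zero.mp (Nat.mul_pos hd0 hpr.pos)⟩
  have hxcast : (x : ZMod (d * p)) = (xu : ZMod (d * p)) := by rw [hx, ZMod.natCast_zmod_val]
  have hxcop : x.Coprime (d * p) := by rw [hx]; exact ZMod.val_coe_unit_coprime xu
  have hxp : x.Coprime p := Nat.Coprime.coprime_mul_left_right hxcop
  set b : ℕ := x ^ (p ^ n) with hbdef
  have hbcop : b.Coprime (d * p) := Nat.Coprime.pow_left _ hxcop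
  have hbp : b.Coprime p := Nat.Coprime.coprime_mul_left_right hbcop
  have hbN : b.Coprime N := (hcop b).mp hbcop
  -- (1) reindex
  have hre : ∑ a ∈ S, G (a * b % N) = ∑ a ∈ S, G a := sum_filter_coprime_mul_mod_eq hN0 hbN G
  -- (2) termwise
  have hterm : ∀ a ∈ S, G (a * b % N) - (C (θ (b : ZMod (d * p))) * Y ^ (r n b)) * G a ∈ I := by
    intro a ha
    simp only [hS, Finset.mem_filter, Finset.mem_range] at ha
    have hap : a.Coprime p := Nat.Coprime.coprime_mul_left_right ((hcop a).mpr ha.2)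
    have habp : (a * b).Coprime p := Nat.Coprime.mul_left hap hbp
    have hcast : ((a * b % N : ℕ) : ZMod (d * p)) = (a : ZMod (d * p)) * (b : ZMod (d * p)) := by
      rw [← Nat.cast_mul, ZMod.natCast_eq_natCast_iff', Nat.mod_mod_of_dvd _ hdpN]
    -- `Y^{r(ab mod N)} ≡ Y^{r(ab)} ≡ Y^{r a + r b}`
    have hw : IsUnit (ω ((a * b : ℕ) : ZMod p)) := isUnit_apply_natCast_of_coprime ω habp
    have h1 : Y ^ (r n (a * b % N)) - Y ^ (r n (a * b)) ∈ I :=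
      C_mul_one_add_X_pow_sub_pow_mem_of_congr hp hu hw (hr.pow_mod_mul_sub_mem hpN habp) (hr n (a * b) habp)
    have h2 : Y ^ (r n (a * b)) - Y ^ (r n a + r n b) ∈ I :=
      C_mul_one_add_X_pow_sub_pow_mem_of_congr hp hu hw (hr n (a * b) habp) (hr.pow_add_mul_sub_mem hap hbp)
    have e : G (a * b % N) - (C (θ (b : ZMod (d * p))) * Y ^ (r n b)) * G a =
        C (θ (a : ZMod (d * p)) * θ (b : ZMod (d * p))) *
          ((Y ^ (r n (a * b % N)) - Y ^ (r n (a * b))) + (Y ^ (r n (a * b)) - Y ^ (r n a + r n b))) := by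
      simp only [hG, hcast, map_mul, pow_add]; ring
    rw [e]
    exact Ideal.mul_mem_left _ _ (Ideal.add_mem _ h1 h2)
  -- (3) `V ≡ θ(b) Y^{r b} V`
  have hV : (1 - C (θ (b : ZMod (d * p))) * Y ^ (r n b)) * ∑ a ∈ S, G a ∈ I := by
    have e : (1 - C (θ (b : ZMod (d * p))) * Y ^ (r n b)) * ∑ a ∈ S, G a =
        ∑ a ∈ S, (G (a * b % N) - (C (θ (b : ZMod (d * p))) * Y ^ (r n b)) * G a) := by
      rw [Finset.sum_sub_distrib, hre, ← Finset.mul_sum]; ring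
    rw [e]
    exact Ideal.sum_mem _ hterm
  -- (4) `Y^{r b} ≡ 1`
  have hone : Y ^ (r n b) - 1 ∈ I := by
    have hwb : IsUnit (ω (b : ZMod p)) := isUnit_apply_natCast_of_coprime ω hbp
    have h2 : u ^ (p ^ n * r n x) * ω (b : ZMod p) - (b : ℤ_[p]) ∈ Ideal.span {(p : ℤ_[p]) ^ (n + 1)} := by
      have hωb : ω (b : ZMod p) = ω (x : ZMod p) ^ (p ^ n) := by rw [hbdef, Nat.cast_pow, map_pow]
      rw [hωb, pow_mul', ← mul_pow, hbdef, Nat.cast_pow]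
      exact Ideal.mem_of_dvd _ (sub_dvd_pow_sub_pow _ _ _) (hr n x hxp)
    have h3 : Y ^ (r n b) - Y ^ (p ^ n * r n x) ∈ I :=
      C_mul_one_add_X_pow_sub_pow_mem_of_congr hp hu hwb (hr n b hbp) h2
    -- `Y^{pⁿ·r x} ≡ 1`: `(1+T)^{pⁿ m} ≡ 1 (mod h_n)` and `u^{pⁿ m} ≡ 1 (mod p^{n+1})`
    have h4 : Y ^ (p ^ n * r n x) - 1 ∈ I := by
      have e : Y ^ (p ^ n * r n x) - 1 =
          C (u ^ (p ^ n * r n x)) * (((1 + X : IwasawaAlgebra p) ^ (p ^ n)) ^ (r n x) - 1) +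
            C (u ^ (p ^ n * r n x) - 1) := by
        rw [hY, mul_pow, ← map_pow, ← pow_mul, map_sub, map_one]; ring
      rw [e]
      refine Ideal.add_mem _ (Ideal.mem_sup_right (Ideal.mul_mem_left _ _ (Ideal.mem_span_singleton.mpr ?_)))
        (Ideal.mem_sup_left (C_mem_span_C_of_mem_span ?_))
      · rw [layerModulus_def]
        simpa using sub_dvd_pow_sub_pow ((1 + X : IwasawaAlgebra p) ^ (p ^ n)) 1 (r n x)
      · have hup : (p : ℤ_[p]) ∣ u - 1 := (PadicInt.norm_lt_one_iff_dvd _).mp hu.norm_sub_one_lt_one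
        exact pow_sub_one_mem_span_pow_succ_of_dvd hup (Dvd.intro _ rfl)
    have e : Y ^ (r n b) - 1 = (Y ^ (r n b) - Y ^ (p ^ n * r n x)) + (Y ^ (p ^ n * r n x) - 1) := by ring
    rw [e]; exact Ideal.add_mem _ h3 h4
  -- (5) `1 − θ(b)` is a unit
  have hunit : IsUnit (C (1 - θ (b : ZMod (d * p))) : IwasawaAlgebra p) := by
    refine IsUnit.map C ?_
    have hθb : θ (b : ZMod (d * p)) = θ (xu : ZMod (d * p)) ^ (p ^ n) := by
      rw [hbdef, Nat.cast_pow, map_pow, hxcast]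
    rw [hθb]
    have hfin : θ (xu : ZMod (d * p)) ^ (Fintype.card (ZMod (d * p))ˣ) = 1 := by
      rw [← MulChar.coe_toUnitHom, ← Units.val_pow_eq_pow_val, ← map_pow, pow_card_eq_one, map_one, Units.val_one]
    have hne : θ (xu : ZMod (d * p)) ^ (p ^ n) ≠ 1 :=
      pow_prime_pow_ne_one_of_pow_eq_one hp Fintype.card_ne_zero hfin hxu n
    refine isUnit_one_sub_of_pow_eq_one hp (m := Fintype.card (ZMod (d * p))ˣ) Fintype.card_ne_zero ?_ hne
    rw [← pow_mul, Nat.mul_comm (p ^ n) (Fintype.card (ZMod (d * p))ˣ), pow_mul, hfin, one_pow]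
  -- (6) assemble
  have hfinal : C (1 - θ (b : ZMod (d * p))) * ∑ a ∈ S, G a ∈ I := by
    have e : C (1 - θ (b : ZMod (d * p))) * ∑ a ∈ S, G a =
        (1 - C (θ (b : ZMod (d * p))) * Y ^ (r n b)) * ∑ a ∈ S, G a +
          C (θ (b : ZMod (d * p))) * ((Y ^ (r n b) - 1) * ∑ a ∈ S, G a) := by
      rw [map_sub, map_one]; ring
    rw [e]
    exact Ideal.add_mem _ hV (Ideal.mul_mem_left _ _ (Ideal.mul_mem_right _ _ hone))
  exact (Ideal.unit_mul_mem_iff_mem _ hunit).mp hfinal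

/-- **`ψ(a)·ω(a) = θ(a)`** for `ψ = θω⁻¹` mod `dp` (`oddBranch`) and `a` prime to `dp`.
[cite: Lang1990, Ch. 10 §2 (PDF p. 171, «θω⁻¹»)] -/
theorem StickelbergerSeries.oddBranch_apply_mul_apply {p : ℕ} [Fact p.Prime] {d : ℕ}
    (θ : DirichletCharacter ℤ_[p] (d * p)) (ω : DirichletCharacter ℤ_[p] p) {a : ℕ} (ha : a.Coprime (d * p)) :
    oddBranch p d θ ω (a : ZMod (d * p)) * ω (a : ZMod p) = θ (a : ZMod (d * p)) := by
  rw [oddBranch_def, MulChar.mul_apply, MulChar.inv_apply_eq_inv]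
  have hω : DirichletCharacter.changeLevel (dvd_mul_level p d) ω (a : ZMod (d * p)) = ω (a : ZMod p) := by
    have := DirichletCharacter.changeLevel_eq_cast_of_dvd' ω (dvd_mul_level p d) (a := (a : ℤ))
      (Nat.isCoprime_iff_coprime.mpr ha)
    push_cast at this
    exact this
  rw [hω, mul_assoc, Ring.inverse_mul_cancel _ (isUnit_apply_natCast_of_coprime ω
    (Nat.Coprime.coprime_mul_left_right ha)), mul_one]

/-- **(hint) The Stickelberger layer is `p^{n+1}` times an element of `Λ` modulo `h_n`**: for `θ ≠ 1` (even or not),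
`ψ = θω⁻¹`, some `q ∈ Λ` has `p^{n+1}·q ≡ Σ_a ψ(a)·a·(1+T)^{r_n(a)} (mod h_n)` — Lang's «`f ∈ 𝔬[[X]]` for `θ ≠ 1`»
at finite level: `ψ(a)·a ≡ ψ(a)ω(a)u^{r(a)} = θ(a)u^{r(a)} (mod p^{n+1})` and the `θ`-sum lies in `(p^{n+1}, h_n)`.
[cite: Lang1990, Ch. 10 §1 Thm 1.2 and §2 (2)–(3) (PDF pp. 168, 171)] -/
theorem StickelbergerSeries.exists_C_pow_mul_sub_stickelbergerLayer_mem {p : ℕ} [Fact p.Prime] (hp : p ≠ 2)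
    {d : ℕ} (hd : d.Coprime p) {u : ℤ_[p]} (hu : KubotaLeopoldt.IsTopGenerator p u)
    {ω : DirichletCharacter ℤ_[p] p} {r : ℕ → ℕ → ℕ} (hr : IsLogTable p u ω r)
    {θ : DirichletCharacter ℤ_[p] (d * p)} (hθ : θ ≠ 1) (n : ℕ) :
    ∃ q : IwasawaAlgebra p, C ((p : ℤ_[p]) ^ (n + 1)) * q - stickelbergerLayer p d (oddBranch p d θ ω) r n ∈
      Ideal.span {layerModulus p n} := by
  set I : Ideal (IwasawaAlgebra p) :=
    Ideal.span {(C ((p : ℤ_[p]) ^ (n + 1)) : IwasawaAlgebra p)} ⊔ Ideal.span {layerModulus p n} with hI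
  have hV := sum_character_mul_C_mul_one_add_X_pow_mem_sup hp hd hu hr hθ n
  have hL : stickelbergerLayer p d (oddBranch p d θ ω) r n ∈ I := by
    rw [stickelbergerLayer_def]
    have hdiff : ∀ a ∈ (Finset.range (d * p ^ (n + 1))).filter (fun a => a.Coprime (d * p)),
        C (oddBranch p d θ ω (a : ZMod (d * p)) * (a : ℤ_[p])) * (1 + X : IwasawaAlgebra p) ^ (r n a) -
          C (θ (a : ZMod (d * p))) * (C u * (1 + X) : IwasawaAlgebra p) ^ (r n a) ∈ I := by
      intro a ha
      rw [Finset.mem_filter] at ha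
      have hap : a.Coprime p := Nat.Coprime.coprime_mul_left_right ha.2
      have e : C (oddBranch p d θ ω (a : ZMod (d * p)) * (a : ℤ_[p])) * (1 + X : IwasawaAlgebra p) ^ (r n a) -
          C (θ (a : ZMod (d * p))) * (C u * (1 + X) : IwasawaAlgebra p) ^ (r n a) =
          C (-(oddBranch p d θ ω (a : ZMod (d * p))) * (u ^ (r n a) * ω (a : ZMod p) - a)) *
            (1 + X : IwasawaAlgebra p) ^ (r n a) := by
        rw [← oddBranch_apply_mul_apply θ ω ha.2, mul_pow, ← map_pow]
        simp only [map_mul, map_neg, map_sub]; ring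
      rw [e]
      refine Ideal.mem_sup_left (Ideal.mul_mem_right _ _ (C_mem_span_C_of_mem_span ?_))
      exact Ideal.mul_mem_left _ _ (hr n a hap)
    have e : (∑ a ∈ (Finset.range (d * p ^ (n + 1))).filter (fun a => a.Coprime (d * p)),
        C (oddBranch p d θ ω (a : ZMod (d * p)) * (a : ℤ_[p])) * (1 + X : IwasawaAlgebra p) ^ (r n a)) =
        (∑ a ∈ (Finset.range (d * p ^ (n + 1))).filter (fun a => a.Coprime (d * p)),
          (C (oddBranch p d θ ω (a : ZMod (d * p)) * (a : ℤ_[p])) * (1 + X : IwasawaAlgebra p) ^ (r n a) -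
            C (θ (a : ZMod (d * p))) * (C u * (1 + X) : IwasawaAlgebra p) ^ (r n a))) +
        ∑ a ∈ (Finset.range (d * p ^ (n + 1))).filter (fun a => a.Coprime (d * p)),
          C (θ (a : ZMod (d * p))) * (C u * (1 + X) : IwasawaAlgebra p) ^ (r n a) := by
      rw [← Finset.sum_add_distrib]; simp only [sub_add_cancel]
    rw [e]
    exact Ideal.add_mem _ (Ideal.sum_mem _ hdiff) hV
  obtain ⟨y, hy, z, hz, hyz⟩ := Submodule.mem_sup.mp hL
  obtain ⟨q, rfl⟩ := Ideal.mem_span_singleton'.mp hy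
  refine ⟨q, ?_⟩
  have e : C ((p : ℤ_[p]) ^ (n + 1)) * q - stickelbergerLayer p d (oddBranch p d θ ω) r n = -z := by
    rw [← hyz]; ring
  rw [e, Ideal.neg_mem_iff]; exact hz

end Integrality


/-! ## The distribution relation (hdist): `L_{n+1} ≡ p·L_n (mod h_n)` -/

section Distribution

/-- Splitting a sum over `range (N·m)` into `m` blocks of length `N`. [cite: Lang1990, Ch. 10 §1 (PDF p. 168, «a mod dp^{n+1}» vs «a mod dpⁿ»)] -/
theorem sum_range_mul_eq_sum_sum {M : Type*} [AddCommMonoid M] (H : ℕ → M) (N m : ℕ) :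
    ∑ a ∈ Finset.range (N * m), H a = ∑ k ∈ Finset.range m, ∑ a ∈ Finset.range N, H (a + k * N) := by
  induction m with
  | zero => simp
  | succ m ih =>
    rw [Nat.mul_succ, Finset.sum_range_add, ih, Finset.sum_range_succ]
    congr 1
    exact Finset.sum_congr rfl fun a _ => by rw [show N * m + a = a + m * N by ring]

/-- `ω(−1) = −1` for the Teichmüller character, `p` odd. [cite: Lang1990, Ch. 10 §2 (PDF p. 171, «θω⁻¹ is odd»)] -/
theorem IsTeichmullerCharacter.apply_neg_one {p : ℕ} [Fact p.Prime] (hp : p ≠ 2) {ω : DirichletCharacter ℤ_[p] p}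
    (hω : IsTeichmullerCharacter p ω) : ω (-1) = -1 := by
  have hpr : p.Prime := Fact.out
  have hsq : ω (-1) * ω (-1) = 1 := by rw [← map_mul, neg_mul_neg, one_mul, map_one]
  rcases mul_self_eq_one_iff.mp hsq with h | h
  · exfalso
    have ht := hω (-1)
    rw [Units.val_neg, Units.val_one, h, map_one] at ht
    have h2 : ((2 : ℕ) : ZMod p) = 0 := by
      have e : (2 : ZMod p) = 0 := by linear_combination ht
      exact_mod_cast e
    rw [ZMod.natCast_eq_zero_iff] at h2
    have := Nat.le_of_dvd two_pos h2
    have := hpr.two_le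
    omega
  · exact h

/-- **`ψ = θω⁻¹` is odd, hence `≠ 1`**, for `θ` even (`p` odd). [cite: Lang1990, Ch. 10 §2 (PDF p. 171, «The character θω⁻¹ is odd»)] -/
theorem StickelbergerSeries.oddBranch_ne_one {p : ℕ} [Fact p.Prime] (hp : p ≠ 2) {d : ℕ} (hd : d.Coprime p)
    {θ : DirichletCharacter ℤ_[p] (d * p)} (hθe : θ.Even) {ω : DirichletCharacter ℤ_[p] p}
    (hω : IsTeichmullerCharacter p ω) : oddBranch p d θ ω ≠ 1 := by
  have hpr : p.Prime := Fact.out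
  have hd0 : 0 < d := Nat.pos_of_ne_zero (by rintro rfl; simp [Nat.coprime_zero_left, hpr.ne_one] at hd)
  haveI : NeZero (d * p) := ⟨Nat.pos_iff_ne_zero.mp (Nat.mul_pos hd0 hpr.pos)⟩
  intro h1
  have hval : oddBranch p d θ ω (-1) = -1 := by
    rw [oddBranch_def, MulChar.mul_apply, MulChar.inv_apply_eq_inv, hθe]
    have hω1 : DirichletCharacter.changeLevel (dvd_mul_level p d) ω (-1 : ZMod (d * p)) = -1 := by
      have := DirichletCharacter.changeLevel_eq_cast_of_dvd' ω (dvd_mul_level p d) (a := -1)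
        (Int.isCoprime_iff_gcd_eq_one.mpr (by simp))
      push_cast at this
      rw [this, IsTeichmullerCharacter.apply_neg_one hp hω]
    rw [hω1, one_mul]
    have h2 : Ring.inverse (-1 : ℤ_[p]) * (-1) = 1 := Ring.inverse_mul_cancel _ isUnit_one.neg
    rw [mul_neg_one, neg_eq_iff_eq_neg] at h2
    exact h2
  rw [h1, MulChar.one_apply isUnit_one.neg] at hval
  have h2 : ((2 : ℕ) : ℤ_[p]) = 0 := by
    have e : (2 : ℤ_[p]) = 0 := by linear_combination hval
    exact_mod_cast e
  exact absurd (Nat.cast_eq_zero.mp h2) (by norm_num)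

/-- **(hdist) The distribution relation of the Stickelberger layers**: `L_{n+1} ≡ p·L_n (mod h_n)` for `ψ ≠ 1`
(`p` odd, `d` prime to `p`).  Split `a' = a + kN_n` (`k < p`): `ψ(a') = ψ(a)`, `σ_{a'} = σ_a` on `Γ_n`, and
`Σ_k (a + kN_n) = p·a + N_n·p(p−1)/2`; the last term contributes `N_n·(p(p−1)/2)·Σ_a ψ(a)σ_a ≡ 0` by
`sum_character_mul_one_add_X_pow_mem_span_layerModulus`.  (The distribution property of `E_1`.)
[cite: Lang1990, Ch. 10 §1 Thm 1.1–1.2 (PDF pp. 167–168, E_{1,c} is a measure), §2 (2)–(3) (PDF p. 171)] -/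
theorem StickelbergerSeries.stickelbergerLayer_succ_sub_mem {p : ℕ} [Fact p.Prime] (hp : p ≠ 2) {d : ℕ}
    (hd : d.Coprime p) {u : ℤ_[p]} (hu : KubotaLeopoldt.IsTopGenerator p u) {ω : DirichletCharacter ℤ_[p] p}
    {r : ℕ → ℕ → ℕ} (hr : IsLogTable p u ω r) {ψ : DirichletCharacter ℤ_[p] (d * p)} (hψ : ψ ≠ 1) (n : ℕ) :
    stickelbergerLayer p d ψ r (n + 1) - C (p : ℤ_[p]) * stickelbergerLayer p d ψ r n ∈
      Ideal.span {layerModulus p n} := by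
  have hpr : p.Prime := Fact.out
  set N := d * p ^ (n + 1) with hNdef
  have hdpN : d * p ∣ N := ⟨p ^ n, by rw [hNdef, pow_succ]; ring⟩
  have hpN : p ^ (n + 1) ∣ N := Dvd.intro_left d rfl
  have hpN1 : p ∣ N := (dvd_pow_self p (Nat.succ_ne_zero n)).trans hpN
  set S := (Finset.range N).filter (fun a => a.Coprime (d * p)) with hS
  -- the level-`n+1` summand and its level-`n` replacement
  set F : ℕ → IwasawaAlgebra p := fun a => C (ψ (a : ZMod (d * p)) * (a : ℤ_[p])) * (1 + X) ^ (r (n + 1) a)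
    with hF
  set F' : ℕ → ℕ → IwasawaAlgebra p :=
    fun k a => C (ψ (a : ZMod (d * p)) * ((a + k * N : ℕ) : ℤ_[p])) * (1 + X) ^ (r n a) with hF'
  -- Step 1: `L_{n+1} = Σ_{k<p} Σ_{a ∈ S} F(a + kN)`
  have hL1 : stickelbergerLayer p d ψ r (n + 1) = ∑ k ∈ Finset.range p, ∑ a ∈ S, F (a + k * N) := by
    rw [stickelbergerLayer_def, show d * p ^ (n + 1 + 1) = N * p by rw [hNdef, pow_succ, mul_assoc],
      Finset.sum_filter, sum_range_mul_eq_sum_sum]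
    refine Finset.sum_congr rfl fun k _ => ?_
    rw [hS, Finset.sum_filter]
    refine Finset.sum_congr rfl fun a _ => ?_
    have hiff : (a + k * N).Coprime (d * p) ↔ a.Coprime (d * p) := by
      rw [show k * N = (k * p ^ n) * (d * p) by rw [hNdef, pow_succ]; ring]
      exact Nat.coprime_add_mul_right_left _ _ _
    by_cases ha : a.Coprime (d * p)
    · rw [if_pos ha, if_pos (hiff.mpr ha)]
    · rw [if_neg ha, if_neg (fun h => ha (hiff.mp h))]
  -- Step 2: termwise `F(a + kN) ≡ F' k a (mod h_n)`
  have hterm : ∀ k, ∀ a ∈ S, F (a + k * N) - F' k a ∈ Ideal.span {layerModulus p n} := by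
    intro k a ha
    rw [hS, Finset.mem_filter] at ha
    have hap : a.Coprime p := Nat.Coprime.coprime_mul_left_right ha.2
    have hakp : (a + k * N).Coprime p := by
      rw [show k * N = (k * (d * p ^ n)) * p by rw [hNdef, pow_succ]; ring]
      exact (Nat.coprime_add_mul_right_left _ _ _).mpr hap
    have hcast : ((a + k * N : ℕ) : ZMod (d * p)) = (a : ZMod (d * p)) := by
      have hN0 : ((N : ℕ) : ZMod (d * p)) = 0 := (ZMod.natCast_eq_zero_iff N (d * p)).mpr hdpN
      push_cast; rw [hN0, mul_zero, add_zero]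
    have hcastp : ((a + k * N : ℕ) : ZMod p) = (a : ZMod p) := by
      have hN0 : ((N : ℕ) : ZMod p) = 0 := (ZMod.natCast_eq_zero_iff N p).mpr hpN1
      push_cast; rw [hN0, mul_zero, add_zero]
    -- `u^{r_{n+1}(a+kN)} ω(a) ≡ a (mod p^{n+1})`
    have h1 : u ^ (r (n + 1) (a + k * N)) * ω (a : ZMod p) - (a : ℤ_[p]) ∈ Ideal.span {(p : ℤ_[p]) ^ (n + 1)} := by
      have h := hr (n + 1) (a + k * N) hakp
      rw [hcastp] at h
      have h' : u ^ (r (n + 1) (a + k * N)) * ω (a : ZMod p) - ((a + k * N : ℕ) : ℤ_[p]) ∈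
          Ideal.span {(p : ℤ_[p]) ^ (n + 1)} :=
        Ideal.span_singleton_le_span_singleton.mpr (pow_dvd_pow _ (Nat.le_succ _)) h
      have h'' : ((a + k * N : ℕ) : ℤ_[p]) - (a : ℤ_[p]) ∈ Ideal.span {(p : ℤ_[p]) ^ (n + 1)} := by
        obtain ⟨q, hq⟩ := hpN
        refine Ideal.mem_span_singleton'.mpr ⟨((k * q : ℕ) : ℤ_[p]), ?_⟩
        rw [hq]; push_cast; ring
      have e : u ^ (r (n + 1) (a + k * N)) * ω (a : ZMod p) - (a : ℤ_[p]) =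
          (u ^ (r (n + 1) (a + k * N)) * ω (a : ZMod p) - ((a + k * N : ℕ) : ℤ_[p])) +
            (((a + k * N : ℕ) : ℤ_[p]) - a) := by ring
      rw [e]; exact Ideal.add_mem _ h' h''
    have h2 := one_add_X_pow_sub_pow_mem_of_congr hp hu (isUnit_apply_natCast_of_coprime ω hap) h1 (hr n a hap)
    have e : F (a + k * N) - F' k a =
        C (ψ (a : ZMod (d * p)) * ((a + k * N : ℕ) : ℤ_[p])) *
          ((1 + X : IwasawaAlgebra p) ^ (r (n + 1) (a + k * N)) - (1 + X) ^ (r n a)) := by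
      simp only [hF, hF', hcast]; ring
    rw [e]
    exact Ideal.mul_mem_left _ _ h2
  -- Step 3: `Σ_k Σ_a F' k a = p·L_n + (N·Σ_k k)·T_n`
  have hsum : ∑ k ∈ Finset.range p, ∑ a ∈ S, F' k a =
      C (p : ℤ_[p]) * stickelbergerLayer p d ψ r n +
        C ((N * ∑ k ∈ Finset.range p, k : ℕ) : ℤ_[p]) *
          ∑ a ∈ S, C (ψ (a : ZMod (d * p))) * (1 + X : IwasawaAlgebra p) ^ (r n a) := by
    rw [Finset.sum_comm, stickelbergerLayer_def, ← hNdef, ← hS, Finset.mul_sum, Finset.mul_sum,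
      ← Finset.sum_add_distrib]
    refine Finset.sum_congr rfl fun a _ => ?_
    have inner : ∑ k ∈ Finset.range p, F' k a =
        C (ψ (a : ZMod (d * p)) * ∑ k ∈ Finset.range p, ((a + k * N : ℕ) : ℤ_[p])) * (1 + X) ^ (r n a) := by
      simp only [hF']
      rw [← Finset.sum_mul, ← map_sum, ← Finset.mul_sum]
    have hinner : ∑ k ∈ Finset.range p, ((a + k * N : ℕ) : ℤ_[p]) =
        (p : ℤ_[p]) * a + ((N * ∑ k ∈ Finset.range p, k : ℕ) : ℤ_[p]) := by
      push_cast
      rw [Finset.sum_add_distrib, Finset.sum_const, Finset.card_range, nsmul_eq_mul, Finset.mul_sum]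
      congr 1
      exact Finset.sum_congr rfl fun k _ => by ring
    rw [inner, hinner]
    simp only [map_mul, map_add, map_natCast]
    ring
  -- Step 4: assemble
  have hT := sum_character_mul_one_add_X_pow_mem_span_layerModulus hp hd hu hr hψ n
  have e : stickelbergerLayer p d ψ r (n + 1) - C (p : ℤ_[p]) * stickelbergerLayer p d ψ r n =
      (∑ k ∈ Finset.range p, ∑ a ∈ S, (F (a + k * N) - F' k a)) +
        C ((N * ∑ k ∈ Finset.range p, k : ℕ) : ℤ_[p]) *
          ∑ a ∈ S, C (ψ (a : ZMod (d * p))) * (1 + X : IwasawaAlgebra p) ^ (r n a) := by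
    have e1 : (∑ k ∈ Finset.range p, ∑ a ∈ S, (F (a + k * N) - F' k a)) =
        (∑ k ∈ Finset.range p, ∑ a ∈ S, F (a + k * N)) - ∑ k ∈ Finset.range p, ∑ a ∈ S, F' k a := by
      rw [← Finset.sum_sub_distrib]
      exact Finset.sum_congr rfl fun k _ => Finset.sum_sub_distrib _ _
    rw [e1, ← hL1, hsum]; ring
  rw [e]
  refine Ideal.add_mem _ (Ideal.sum_mem _ fun k _ => Ideal.sum_mem _ fun a ha => hterm k a ha) ?_
  exact Ideal.mul_mem_left _ _ hT

end Distribution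

/-! ## EXISTENCE of the Stickelberger-branch series (Lang Ch. 10 Thm 1.2 in the tree's currency) -/

section Existence

/-- **Lang Ch. 10 Thm 1.2 / §2 — EXISTENCE of `f_{θ,1}`**: for `p` odd, `d` prime to `p`, `θ ≠ 1` an even Dirichlet
character mod `dp` (`ℤ_p`-valued), `ω` the Teichmüller character, `u` a topological generator with `γ`-log table
`r`, there IS `f ∈ Λ` with `d·p^{n+1}·f ≡ Σ_{a<dp^{n+1},(a,dp)=1} θω⁻¹(a)·a·(1+T)^{r_n(a)} (mod h_n)` for every `n`.
(Unique by `IsStickelbergerSeries.unique`.)  Assembled from the integrality congruence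
(`exists_C_pow_mul_sub_stickelbergerLayer_mem`), the distribution relation (`stickelbergerLayer_succ_sub_mem`) and the
projective limit (`exists_isStickelbergerSeries_of_layers`).
[cite: Lang1990, Ch. 10 §1 Thm 1.2 (PDF pp. 167–168) and §2 (2)–(3) (PDF p. 171, «f(X) = f_θ(X) … θ ≠ 1 … f ∈ Λ»)] -/
theorem StickelbergerSeries.exists_isStickelbergerSeries {p : ℕ} [Fact p.Prime] (hp : p ≠ 2) {d : ℕ}
    (hd : d.Coprime p) {θ : DirichletCharacter ℤ_[p] (d * p)} (hθ : θ ≠ 1) (hθe : θ.Even)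
    {ω : DirichletCharacter ℤ_[p] p} (hω : IsTeichmullerCharacter p ω) {u : ℤ_[p]}
    (hu : KubotaLeopoldt.IsTopGenerator p u) {r : ℕ → ℕ → ℕ} (hr : IsLogTable p u ω r) :
    ∃ f : IwasawaAlgebra p, IsStickelbergerSeries p d (oddBranch p d θ ω) r f :=
  exists_isStickelbergerSeries_of_layers hd (fun n => exists_C_pow_mul_sub_stickelbergerLayer_mem hp hd hu hr hθ n)
    (fun n => stickelbergerLayer_succ_sub_mem hp hd hu hr (oddBranch_ne_one hp hd hθe hω) n)

/-- **… and the series is unique.** [cite: Lang1990, Ch. 10 §1 Thm 1.2 (PDF pp. 167–168)] -/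
theorem StickelbergerSeries.existsUnique_isStickelbergerSeries {p : ℕ} [Fact p.Prime] (hp : p ≠ 2) {d : ℕ}
    (hd : d.Coprime p) {θ : DirichletCharacter ℤ_[p] (d * p)} (hθ : θ ≠ 1) (hθe : θ.Even)
    {ω : DirichletCharacter ℤ_[p] p} (hω : IsTeichmullerCharacter p ω) {u : ℤ_[p]}
    (hu : KubotaLeopoldt.IsTopGenerator p u) {r : ℕ → ℕ → ℕ} (hr : IsLogTable p u ω r) :
    ∃! f : IwasawaAlgebra p, IsStickelbergerSeries p d (oddBranch p d θ ω) r f := by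
  obtain ⟨f, hf⟩ := exists_isStickelbergerSeries hp hd hθ hθe hω hu hr
  exact ⟨f, hf, fun g hg => IsStickelbergerSeries.unique p hd hg hf⟩

end Existence

end Literature.NumberTheory.IwasawaTheory

end
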